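import Summits.BirchSwinnertonDyer.Rank1Residual.GaloisImage.SelmerLocalKerUnramifiedOfKummerCondition
import Literature.NumberTheory.EllipticCurves.CongruenceVisibilityComparison
import HarnessLib

/-!
# THE TAMAGAWA-FREE LOCAL CONDITION IS THE UNRAMIFIED CONDITION: at a finite place `v ∤ p` with
# `p ∤ c_v(E)` (ANY reduction type, ANY number field, ANY prime `p`), `𝓢_v(E) = unramifiedKer (E[p^k]) 𝔓`
# for every prime `𝔓 ∣ v` — (L1a), (L1b), (L1) of x10's SPEC and the two-curve corollary, via (ROOT)
# (team n1011, seat p04 GEN 16 — row T-URTAM, TOOL; FILE 1 of 2)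

HONEST FRAMING (cell `b2b-bsdres-*`, team n1011, verbatim): the goal of the cell is to DELETE the
COMBINATION-SHAPED residual classes for ALL analytic-rank `≤ 1` curves over `ℚ` — "full BSD formula for
every rank `≤ 1` curve in class `C`" assembled STRICTLY from published theorems — so that the rank-`≤ 1`
remainder becomes exactly the CONSTRUCTION-SHAPED classes, which are TYPED (missing-input `Prop`s), NOT
attempted; this is not "finishing BSD". Team n1011: research route on CONSTRUCTION-SHAPED X4 / §I
N10–N11. Row T-URTAM (x10 GEN 28's by-name SPEC (L1), `HOME/class-closure/N2/L1-SPEC-x10g28.md`) is a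
TOOL theorem — it closes NO class and NO pair by itself; records that later cite it remain CERTIFICATE
EVIDENCE under their displayed binders; nothing booked; no residual-map mark / label / tier / count moved.
THEOREMS ONLY: no definition, no named fact, no `sorry`.

## What

For an elliptic curve `E = W` over a number field `K`, a prime `p` (`p = 2` allowed), a finite place
`v ∤ p` of ANY reduction type whose local Tamagawa number
`c_v = (W.baseChange (v.adicCompletion K)).localTamagawaNumber (v.adicCompletionIntegers K)` (tree
`Tamagawa.lean`, computed on the minimal model) is prime to `p`, and any prime `𝔓` of `\bar ℤ_K` above `v`:

* §1 **(ROOT) from `p ∤ c_v`** — `rootable_adicCompletionPrime_of_not_dvd_localTamagawaNumber` /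
  `rootable_of_not_dvd_localTamagawaNumber`: every `K_v`-rational `p`-power torsion point of `E` has
  `I_v`-fixed `p^k`-th roots for every `k`.  The sibling `InertiaRootableNonsplitMultiplicative` (seat p10
  GEN 14, row T-ROOT) proves this at a NON-SPLIT multiplicative `v ∤ p`, `p` odd, from `c_v ∣ 2`; the only
  use of "non-split, `p` odd" there is the line "`2 • t ∈ M₀` and `t` has odd order, so `t ∈ M₀`".  Here
  that line is Bézout for `gcd(p^j, c_v) = 1`.  Currency of sub-cell multr1-p2 (`M₀ = nonsingularPart ≤
  E(K̄)^{I_v}`, Silverman's `E₀(K_v^nr)`): a `D_v`-fixed `t ∈ E[p^∞]` is killed by `φ − 1`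
  (`inertiaSubOne_eq_zero_iff`); `[E(K̄)^{D_v} : E(K̄)^{D_v} ⊓ M₀] ∣ c_v`
  (`relIndex_nonsingularPart_ker_dvd_localTamagawaNumber`: `E(K_v)/E₀(K_v) ↪ Φ_v(k̄)^{Frob}`; Greenberg
  LNM 1716, remark after the proof of Lemma 3.3, p. 88: "`|ker(r_v)| = c_v^{(p)}` … Recall that
  `c_v = [E(F_v) : E_0(F_v)]`"), so `c_v • t ∈ M₀`, hence `t = a · (c_v • t) ∈ M₀`; and `M₀[p^∞]` is
  `p`-divisible (`exists_nsmul_eq_of_mem_nonsingularPart_of_localDivisible` fed by the reduction-type-free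
  (LocDiv) `localDivisible_nonsingular_torsion`; Kodaira–Néron over `K_v^nr` enters via `finiteIndex_nonsingularPart`).
* §2 **(L1)** `selmerLocalKer_eq_unramifiedKer_of_not_dvd_localTamagawaNumber` —
  `selmerLocalKer W (v.adicCompletion K) (p : ℤ) = unramifiedKer (geomTorsion W (p : ℤ)) 𝔓`: the local
  Selmer condition at `v` ("the class dies in `H¹(K_v, E)`") IS "unramified at `𝔓`" ("principal on the
  inertia group `I_𝔓 ≤ Γ_K`"); level `p^k`: `…_pow`, `…_of_eq_pow`; `𝔓₀`-form `…_adicCompletionPrime_…`.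
  Road: row T-ROOT's `selmerLocalKer_eq_unramifiedKer_of_rootable` (`SelmerLocalKerUnramifiedOfKummerCondition`)
  at the chosen prime `𝔓₀ = adicCompletionPrime K v`, fed with §1; `Γ_K` is transitive on the primes
  above `v` (`exists_smul_eq_of_mem_primesAbove_holds`) and `unramifiedKer_smul` moves it to every `𝔓 ∣ v`.
  Common parent of the tree's `selmerLocalKer_eq_unramifiedKer` (GOOD, `c_v = 1`), of row T-ROOT's
  `selmerLocalKer_eq_unramifiedKer_of_nonsplit'` (NON-SPLIT, `p` odd, `c_v ∣ 2`) and of the cell's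
  conditional `NonsplitKummer.unramifiedKer_le_selmerLocalKer_of_nonsplit` (Tate uniformisation A41).
  **(L1a)** `unramifiedKer_le_selmerLocalKer_of_not_dvd_localTamagawaNumber` — LITERALLY the hypothesis
  `hur` of the tree's `relIndex_map_selmerLocalKer_eq_one_of_unramifiedKer_le`
  (`CongruenceVisibilityComparison`), whose docstring names it "the statement
  `H¹(K_v^nr/K_v, E(K_v^nr))[n] = 0` (Milne *ADT* I Prop. 3.8: that group is `H¹(k_v, Φ_v)`, of order the
  Tamagawa number `c_v(E)`) in general".  **(L1b)** `selmerLocalKer_le_unramifiedKer_of_not_dvd_localTamagawaNumber`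
  — the bad-reduction companion of Silverman X.4.4 `selmerLocalKer_le_unramifiedKer`.
* §3 **COROLLARY (two curves)** `selmerLocalKer_iff_h1Equiv_of_not_dvd_localTamagawaNumber` — for a
  `Γ_K`-isomorphism `θ : E′[p] ⥲ E[p]` and `v ∤ p` with `p ∤ c_v(E)`, `p ∤ c_v(E′)`:
  `c′ ∈ 𝓢_v(E′) ↔ θ_* c′ ∈ 𝓢_v(E)` — the binder `hagree` of x10's
  `SelmerCompanions.natCard_selmerGroup_eq_of_congr_of_agree_rat` at `v` (`mem_unramifiedKer_iff_h1Equiv_mem`);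
  product form `…_mul` (`p ∤ c_v(E) · c_v(E′)`), one-sided `h1Equiv_mem_selmerLocalKer_of_not_dvd_localTamagawaNumber`,
  and the comparison index `relIndex_map_selmerLocalKer_eq_one_of_not_dvd_localTamagawaNumber`
  (`ι_v(θ) = 1`: the place is FREE in the visibility count `exists_sha_ne_zero_of_congr_of_le_off`).

Further currencies (`H¹_ur(K_v, E[p^∞]) = 0`, `𝓛_v(E[p^k]) = H¹_ur(K_v, E[p^k])`, level-`p^k` (L1a)/(L1b),
cocycle criterion, independence of `𝔓`, mixed shape): continuation file `KummerConditionUnramifiedTamagawaFree`.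

References (locators only; no cited FACT): [GreenbergLNM1716] §3 Lemma 3.3 (p. 87) with the remark
after its proof (p. 88), used in §4 proof of Thm. 4.1 (p. 104); [MilneADT2006] I Prop. 3.8, Rem. 3.10;
[GrossLMS1991] §7 (7.1), (7.4); [SilvermanAEC2009] VII.2.1, VII.3.1, VII.6.1–6.2, §VII.6 Ex. 7.6,
Cor. X.4.4, Remark X.4.1.1; [SilvermanATAEC1994] Cor. IV.9.2; [SchaeferStoll2004] §3 Lemma 3.1 and
Prop. 3.2 (held: `paper:schaefer2003-how-do-p-descent-elliptic-curve`); [MazurRubin2004] §2.3;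
[CremonaMazur2000] §3; [NeukirchANT1999] II §9 (9.6).
-/

noncomputable section

open scoped Classical NNReal Pointwise

open NumberField IsDedekindDomain Field IsDedekindDomain.HeightOneSpectrum WeierstrassCurve
open Literature.NumberTheory.EllipticCurves Literature.NumberTheory.EllipticCurves.GreenbergSelmer
open Literature.NumberTheory.GaloisRepresentations
open Literature.NumberTheory.GaloisRepresentations.IsNonarchimedeanLocalField

namespace Summit.BirchSwinnertonDyer.Rank1Residual.GaloisImage.InertiaDivisible

open Summit.BirchSwinnertonDyer.Rank1Residual.X11b.AcSelmer
open Summit.BirchSwinnertonDyer.Rank1Residual.X11b.LocBridge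

variable {K : Type} [Field K] [NumberField K] (W : WeierstrassCurve K) [W.IsElliptic] (p : ℕ)
  [Fact p.Prime]

/-! ## §1. (ROOT) at a Tamagawa-free place `v ∤ p` -/

/-- **(ROOT) at a place `v ∤ p` with `p ∤ c_v`** (`𝔓₀`-form; ANY reduction type, `p = 2` allowed):
every point of `E[p^∞]` fixed by the decomposition group `D_{𝔓₀}` of the chosen prime
`𝔓₀ = adicCompletionPrime K v` has, for every `k`, a `p^k`-th root in `E[p^∞]` fixed by the inertia
group `I_{𝔓₀}`.  Proof (Greenberg's Néron-component road, in sub-cell multr1-p2's currency): let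
`M₀ = nonsingularPart ≤ E(K̄)^{I_v}`.  The point `t` is `D_v`-fixed, i.e. killed by `φ − 1`
(`inertiaSubOne_eq_zero_iff`); `[E(K̄)^{D_v} : E(K̄)^{D_v} ⊓ M₀] ∣ c_v`
(`relIndex_nonsingularPart_ker_dvd_localTamagawaNumber`), so `c_v • t ∈ M₀`; the order `p^j` of `t` is
prime to `c_v` (`p ∤ c_v`), so by Bézout `t = a · (c_v • t) ∈ M₀`; and `M₀[p^∞]` is `p`-divisible
(`exists_nsmul_eq_of_mem_nonsingularPart_of_localDivisible` fed by `localDivisible_nonsingular_torsion`),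
so `t` has `p^k`-th roots in `M₀ ⊆ E(K̄)^{I_v}`.
[cite: GreenbergLNM1716, §3 Lemma 3.3 (p. 87) with the remark after its proof (p. 88), used in §4 proof of Thm. 4.1 (p. 104)]
[cite: SilvermanAEC2009, VII.§2 Prop. 2.1, Prop. VII.3.1, Thm. VII.6.1 / Cor. VII.6.2, §VII.6 Ex. 7.6]
[cite: MilneADT2006, Ch. I Prop. 3.8 and Remark 3.10] -/
theorem rootable_adicCompletionPrime_of_not_dvd_localTamagawaNumber {v : HeightOneSpectrum (𝓞 K)}
    (hpv : (p : 𝓞 K) ∉ v.asIdeal)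
    (hc : ¬ p ∣ (W.baseChange (v.adicCompletion K)).localTamagawaNumber (v.adicCompletionIntegers K))
    (t : W.geomPrimaryTorsion p)
    (ht : ∀ d ∈ (adicCompletionPrime K v).decompositionSubgroup (absoluteGaloisGroup K), d • t = t)
    (k : ℕ) :
    ∃ s : W.geomPrimaryTorsion p,
      (∀ i ∈ (adicCompletionPrime K v).inertia (absoluteGaloisGroup K), i • s = s) ∧ p ^ k • s = t := by
  have hpp : p.Prime := Fact.out
  -- local data (as in `rootable_adicCompletionPrime_of_nonsplit`)
  obtain ⟨w, hw⟩ := v.exists_spectralValuation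
  obtain ⟨𝔐, h𝔐⟩ := v.localPrimesAbove_nonempty
  have hint := WeierstrassCurve.isIntegral_spectralValuation_baseChange hw
    (W.localMinimalIntegralModel v)
  obtain ⟨W₀, hW₀⟩ := hint.integral
  obtain ⟨C, hC⟩ := W.exists_variableChange_eq_localMinimalIntegralModel v
  obtain ⟨Φ, hΦ⟩ := W.exists_addEquiv_localPoints_of_smul_eq v hC
  have hpu : IsUnit ((p : ℕ) : v.adicCompletionIntegers K) := by
    have h := isUnit_algebraMap_adicCompletionIntegers K v hpv
    rwa [map_natCast] at h
  obtain ⟨φ, hφ⟩ := exists_isArithFrobAt_of_mem_primesAbove_holds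
    (adicCompletionPrime_mem_primesAbove K v)
  have hφD : φ ∈ decomp v :=
    (decomp_eq_decompositionSubgroup_adicCompletionPrime v).symm ▸ hφ.mem_stabilizer
  -- the point `P₀ = t` of `Fix = E(K̄)^{I_v}`; it is `D_v`-fixed
  have htI : ∀ i ∈ (adicCompletionPrime K v).inertia (absoluteGaloisGroup K),
      i • (t : W.geomPoints) = t := by
    intro i hi
    have hiD : i ∈ (adicCompletionPrime K v).decompositionSubgroup (absoluteGaloisGroup K) := by
      rw [← decomp_eq_decompositionSubgroup_adicCompletionPrime v]
      exact inertia_adicCompletionPrime_le_decomp v hi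
    rw [← primaryComponent.coe_smul, ht i hiD]
  let P₀ : FixedPoints.addSubgroup ↥((adicCompletionPrime K v).inertia (absoluteGaloisGroup K))
      W.geomPoints := ⟨(t : W.geomPoints), fun i ↦ htI i i.2⟩
  have hP₀coe : ((P₀ : FixedPoints.addSubgroup ↥((adicCompletionPrime K v).inertia
      (absoluteGaloisGroup K)) W.geomPoints) : W.geomPoints) = (t : W.geomPoints) := rfl
  have hP₀D : inertiaSubOne W.geomPoints φ hφD P₀ = 0 := by
    rw [inertiaSubOne_eq_zero_iff W hφ hφD]
    intro x hx
    rw [decomp_eq_decompositionSubgroup_adicCompletionPrime v] at hx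
    rw [hP₀coe, ← primaryComponent.coe_smul, ht x hx]
  -- `c_v • P₀ ∈ M₀`
  set c : ℕ := (W.baseChange (v.adicCompletion K)).localTamagawaNumber (v.adicCompletionIntegers K)
    with hcdef
  have hdvd : (nonsingularPart W hW₀ Φ).relIndex (inertiaSubOne W.geomPoints φ hφD).ker ∣ c :=
    relIndex_nonsingularPart_ker_dvd_localTamagawaNumber hw hW₀ hΦ hφ hφD
  have hcP₀ : c • P₀ ∈ nonsingularPart W hW₀ Φ := by
    have hmem : ((nonsingularPart W hW₀ Φ).addSubgroupOf (inertiaSubOne W.geomPoints φ hφD).ker).index •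
        (⟨P₀, hP₀D⟩ : (inertiaSubOne W.geomPoints φ hφD).ker) ∈
        (nonsingularPart W hW₀ Φ).addSubgroupOf (inertiaSubOne W.geomPoints φ hφD).ker :=
      AddSubgroup.nsmul_index_mem _ _
    rw [AddSubgroup.mem_addSubgroupOf, AddSubgroup.coe_nsmul] at hmem
    obtain ⟨m, hm⟩ := hdvd
    have e : c • P₀ =
        m • ((nonsingularPart W hW₀ Φ).relIndex (inertiaSubOne W.geomPoints φ hφD).ker • P₀) := by
      rw [smul_smul, mul_comm, ← hm]
    rw [e]
    exact AddSubgroup.nsmul_mem _ hmem m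
  -- `P₀ ∈ M₀`: the order `p^j` of `t` is prime to `c_v` (THE Tamagawa-free step: Bézout)
  obtain ⟨j, hj⟩ := (AddCommGroup.mem_primaryComponent).mp t.2
  have hP₀j : p ^ j • P₀ = 0 :=
    Subtype.ext (by rw [AddSubmonoidClass.coe_nsmul, ZeroMemClass.coe_zero, hP₀coe]; exact hj)
  have hcop : IsCoprime (c : ℤ) ((p ^ j : ℕ) : ℤ) :=
    Nat.isCoprime_iff_coprime.mpr ((hpp.coprime_iff_not_dvd.mpr hc).symm.pow_right j)
  obtain ⟨a, b, hab⟩ := hcop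
  have hP₀M₀ : P₀ ∈ nonsingularPart W hW₀ Φ := by
    have e : (a * (c : ℤ) + b * ((p ^ j : ℕ) : ℤ)) • P₀ = P₀ := by rw [hab, one_zsmul]
    rw [add_zsmul, mul_zsmul, mul_zsmul, natCast_zsmul, natCast_zsmul, hP₀j, zsmul_zero,
      add_zero] at e
    rw [← e]
    exact AddSubgroup.zsmul_mem _ hcP₀ a
  have hP₀prim : P₀ ∈ AddCommGroup.primaryComponent
      ↥(FixedPoints.addSubgroup ↥((adicCompletionPrime K v).inertia (absoluteGaloisGroup K))
        W.geomPoints) p :=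
    (AddCommGroup.mem_primaryComponent).mpr ⟨j, hP₀j⟩
  -- `M₀[p^∞]` is `p`-divisible: iterate
  have hdivM₀ := exists_nsmul_eq_of_mem_nonsingularPart_of_localDivisible hw hW₀ hΦ h𝔐 hpu
    (fun Q hfix hQ hk ↦ localDivisible_nonsingular_torsion W v hpv w hw 𝔐 h𝔐 Q hfix hQ hk)
  have key : ∀ k : ℕ, ∃ b : FixedPoints.addSubgroup
      ↥((adicCompletionPrime K v).inertia (absoluteGaloisGroup K)) W.geomPoints,
      b ∈ AddCommGroup.primaryComponent _ p ∧ b ∈ nonsingularPart W hW₀ Φ ∧ p ^ k • b = P₀ := by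
    intro k
    induction k with
    | zero => exact ⟨P₀, hP₀prim, hP₀M₀, by rw [pow_zero, one_nsmul]⟩
    | succ k ih =>
      obtain ⟨b, hbprim, hbM₀, hb⟩ := ih
      obtain ⟨b', hb'prim, hb'M₀, hb'⟩ := hdivM₀ b hbprim hbM₀
      exact ⟨b', hb'prim, hb'M₀, by rw [pow_succ, ← smul_smul, hb', hb]⟩
  obtain ⟨b, hbprim, -, hb⟩ := key k
  obtain ⟨k', hk'⟩ := (AddCommGroup.mem_primaryComponent).mp hbprim
  have hk'' : p ^ k' • (b : W.geomPoints) = 0 := by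
    have h := congrArg (fun z : FixedPoints.addSubgroup
      ↥((adicCompletionPrime K v).inertia (absoluteGaloisGroup K)) W.geomPoints ↦
        (z : W.geomPoints)) hk'
    simpa only [AddSubmonoidClass.coe_nsmul, ZeroMemClass.coe_zero] using h
  refine ⟨⟨(b : W.geomPoints), (AddCommGroup.mem_primaryComponent).mpr ⟨k', hk''⟩⟩,
    fun i hi ↦ Subtype.ext ?_, Subtype.ext ?_⟩
  · rw [primaryComponent.coe_smul]
    exact b.2 ⟨i, hi⟩
  · have h := congrArg (fun z : FixedPoints.addSubgroup
      ↥((adicCompletionPrime K v).inertia (absoluteGaloisGroup K)) W.geomPoints ↦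
        (z : W.geomPoints)) hb
    simpa only [AddSubmonoidClass.coe_nsmul] using h

/-- **(ROOT) at a place `v ∤ p` with `p ∤ c_v`** (local form — the literal binder `hroot` of the
T-ROOT files): every point of `E[p^∞]` fixed by `Γ_{K_v}` (acting through `res : Γ_{K_v} → Γ_K`) has,
for every `k`, a `p^k`-th root fixed by the local inertia group `absInertia K_v`
(`D_{𝔓₀} = res Γ_{K_v}`, `I_{𝔓₀} = res I_{K_v}`).  Any reduction type; `p = 2` allowed.
[cite: GreenbergLNM1716, §3 Lemma 3.3 (p. 87) with the remark after its proof (p. 88), used in §4 proof of Thm. 4.1 (p. 104)]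
[cite: NeukirchANT1999, Ch. II §9 Prop. (9.6)] -/
theorem rootable_of_not_dvd_localTamagawaNumber {v : HeightOneSpectrum (𝓞 K)}
    (hpv : (p : 𝓞 K) ∉ v.asIdeal)
    (hc : ¬ p ∣ (W.baseChange (v.adicCompletion K)).localTamagawaNumber (v.adicCompletionIntegers K))
    (t : W.geomPrimaryTorsion p)
    (ht : ∀ σ : absoluteGaloisGroup (v.adicCompletion K),
      absGaloisRestrict K (v.adicCompletion K) σ • t = t) (k : ℕ) :
    ∃ s : W.geomPrimaryTorsion p,
      (∀ τ ∈ absInertia (v.adicCompletion K), absGaloisRestrict K (v.adicCompletion K) τ • s = s) ∧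
        p ^ k • s = t := by
  have ht' : ∀ d ∈ (adicCompletionPrime K v).decompositionSubgroup (absoluteGaloisGroup K),
      d • t = t := by
    intro d hd
    rw [decompositionSubgroup_adicCompletionPrime_eq_range] at hd
    obtain ⟨σ, rfl⟩ := hd
    exact ht σ
  obtain ⟨s, hs, hps⟩ :=
    rootable_adicCompletionPrime_of_not_dvd_localTamagawaNumber W p hpv hc t ht' k
  exact ⟨s, (forall_inertia_adicCompletionPrime_smul_eq_iff W p v s).mp hs, hps⟩


/-! ## §2. `𝓢_v(E) = unramifiedKer (E[p^k]) 𝔓` at a Tamagawa-free `v ∤ p` -/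

/-- **`𝓢_v(E) = unramifiedKer (E[p^k]) 𝔓₀` at a finite `v ∤ p` with `p ∤ c_v`** (`𝔓₀`-form, level
`p^k`; any reduction type, `p = 2` allowed): row T-ROOT's `selmerLocalKer_eq_unramifiedKer_of_rootable` fed
with (ROOT) from `p ∤ c_v` (`rootable_of_not_dvd_localTamagawaNumber`).
[cite: MilneADT2006, Ch. I Prop. 3.8 and Remark 3.10] [cite: GrossLMS1991, §7 (7.1), (7.4)] -/
theorem selmerLocalKer_eq_unramifiedKer_adicCompletionPrime_of_not_dvd_localTamagawaNumber
    {v : HeightOneSpectrum (𝓞 K)} (hpv : (p : 𝓞 K) ∉ v.asIdeal)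
    (hc : ¬ p ∣ (W.baseChange (v.adicCompletion K)).localTamagawaNumber (v.adicCompletionIntegers K))
    (k : ℕ) :
    selmerLocalKer W (v.adicCompletion K) ((p ^ k : ℕ) : ℤ) =
      unramifiedKer (geomTorsion W ((p ^ k : ℕ) : ℤ)) (adicCompletionPrime K v) :=
  selmerLocalKer_eq_unramifiedKer_of_rootable W p k hpv
    (rootable_of_not_dvd_localTamagawaNumber W p hpv hc)

/-- **(L1) at level `p^k`, every `𝔓 ∣ v`: `𝓢_v(E) = unramifiedKer (E[p^k]) 𝔓` at a finite `v ∤ p` with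
`p ∤ c_v`** (`Γ_K` is transitive on the primes above `v`, `exists_smul_eq_of_mem_primesAbove_holds`;
`unramifiedKer_smul`). [cite: MilneADT2006, Ch. I Prop. 3.8 and Remark 3.10]
[cite: SilvermanAEC2009, Remark X.4.1.1] -/
theorem selmerLocalKer_eq_unramifiedKer_of_not_dvd_localTamagawaNumber_pow
    {v : HeightOneSpectrum (𝓞 K)} (hpv : (p : 𝓞 K) ∉ v.asIdeal)
    (hc : ¬ p ∣ (W.baseChange (v.adicCompletion K)).localTamagawaNumber (v.adicCompletionIntegers K))
    (k : ℕ) {𝔓 : Ideal (absIntegers (𝓞 K) K)} (h𝔓 : 𝔓 ∈ v.primesAbove) :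
    selmerLocalKer W (v.adicCompletion K) ((p ^ k : ℕ) : ℤ) =
      unramifiedKer (geomTorsion W ((p ^ k : ℕ) : ℤ)) 𝔓 := by
  obtain ⟨g, hg⟩ := HeightOneSpectrum.exists_smul_eq_of_mem_primesAbove_holds
    (adicCompletionPrime_mem_primesAbove K v) h𝔓
  rw [← hg, unramifiedKer_smul]
  exact selmerLocalKer_eq_unramifiedKer_adicCompletionPrime_of_not_dvd_localTamagawaNumber W p hpv hc k

/-- (L1) at an integer level `n = p^k` (substitution form). [cite: MilneADT2006, Ch. I Prop. 3.8 and Remark 3.10] -/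
theorem selmerLocalKer_eq_unramifiedKer_of_not_dvd_localTamagawaNumber_of_eq_pow
    {v : HeightOneSpectrum (𝓞 K)} (hpv : (p : 𝓞 K) ∉ v.asIdeal)
    (hc : ¬ p ∣ (W.baseChange (v.adicCompletion K)).localTamagawaNumber (v.adicCompletionIntegers K))
    (k : ℕ) {n : ℤ} (hnk : n = ((p ^ k : ℕ) : ℤ))
    {𝔓 : Ideal (absIntegers (𝓞 K) K)} (h𝔓 : 𝔓 ∈ v.primesAbove) :
    selmerLocalKer W (v.adicCompletion K) n = unramifiedKer (geomTorsion W n) 𝔓 := by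
  subst hnk
  exact selmerLocalKer_eq_unramifiedKer_of_not_dvd_localTamagawaNumber_pow W p hpv hc k h𝔓

/-- **(L1) `𝓢_v(E) = unramifiedKer (E[p]) 𝔓` for EVERY prime `𝔓 ∣ v` at a finite place `v ∤ p` with
`p ∤ c_v(E)`** — ANY reduction type, ANY number field, ANY prime `p`.  The Tamagawa-free local condition
is the unramified condition: a class of `H¹(K, E[p])` dies in `H¹(K_v, E)` iff it is principal on the
inertia group `I_𝔓 ≤ Γ_K`.  Milne, *ADT* I Prop. 3.8 with Remark 3.10 (`H¹(K_v^nr/K_v, E(K_v^nr)) ≅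
H¹(k_v, Φ_v)` has order `c_v`); the good case (`c_v = 1`) is the tree's `selmerLocalKer_eq_unramifiedKer`
(Gross 1991 (7.1)/(7.4)), the non-split multiplicative case (`c_v ∣ 2`, `p` odd) row T-ROOT's
`selmerLocalKer_eq_unramifiedKer_of_nonsplit'`.
[cite: MilneADT2006, Ch. I Prop. 3.8 and Remark 3.10] [cite: GrossLMS1991, §7 (7.1), (7.4)]
[cite: SilvermanAEC2009, Cor. X.4.4 and Remark X.4.1.1] -/
theorem selmerLocalKer_eq_unramifiedKer_of_not_dvd_localTamagawaNumber
    {v : HeightOneSpectrum (𝓞 K)} (hpv : (p : 𝓞 K) ∉ v.asIdeal)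
    (hc : ¬ p ∣ (W.baseChange (v.adicCompletion K)).localTamagawaNumber (v.adicCompletionIntegers K))
    {𝔓 : Ideal (absIntegers (𝓞 K) K)} (h𝔓 : 𝔓 ∈ v.primesAbove) :
    selmerLocalKer W (v.adicCompletion K) (p : ℤ) = unramifiedKer (geomTorsion W (p : ℤ)) 𝔓 :=
  selmerLocalKer_eq_unramifiedKer_of_not_dvd_localTamagawaNumber_of_eq_pow W p hpv hc 1
    (by rw [pow_one]) h𝔓

/-- **(L1a) unramified ⟹ local Selmer condition, at a Tamagawa-free place**: for `v ∤ p` with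
`p ∤ c_v(E)` and any `𝔓 ∣ v`, `unramifiedKer (geomTorsion W p) 𝔓 ≤ selmerLocalKer W (v.adicCompletion K) p`
— literally the hypothesis `hur` of `relIndex_map_selmerLocalKer_eq_one_of_unramifiedKer_le`
(`CongruenceVisibilityComparison`): "`H¹(K_v^nr/K_v, E(K_v^nr))[p] = 0`" when `p ∤ c_v`.
[cite: MilneADT2006, Ch. I Prop. 3.8 and Remark 3.10] [cite: GrossLMS1991, §7 (7.1)] -/
theorem unramifiedKer_le_selmerLocalKer_of_not_dvd_localTamagawaNumber
    {v : HeightOneSpectrum (𝓞 K)} (hpv : (p : 𝓞 K) ∉ v.asIdeal)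
    (hc : ¬ p ∣ (W.baseChange (v.adicCompletion K)).localTamagawaNumber (v.adicCompletionIntegers K))
    {𝔓 : Ideal (absIntegers (𝓞 K) K)} (h𝔓 : 𝔓 ∈ v.primesAbove) :
    unramifiedKer (geomTorsion W (p : ℤ)) 𝔓 ≤ selmerLocalKer W (v.adicCompletion K) (p : ℤ) :=
  (selmerLocalKer_eq_unramifiedKer_of_not_dvd_localTamagawaNumber W p hpv hc h𝔓).ge

/-- **(L1b) local Selmer condition ⟹ unramified, at a Tamagawa-free place**: for `v ∤ p` with
`p ∤ c_v(E)` and any `𝔓 ∣ v`, `selmerLocalKer W (v.adicCompletion K) p ≤ unramifiedKer (geomTorsion W p) 𝔓`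
— the bad-reduction companion of Silverman X.4.4 (tree `selmerLocalKer_le_unramifiedKer`, good `v ∤ n`):
a `K_v`-rational point is `p`-divisible in `E(K_v^nr)` when `p ∤ c_v`, so its Kummer class is unramified.
[cite: SilvermanAEC2009, Cor. X.4.4] [cite: MilneADT2006, Ch. I Prop. 3.8 and Remark 3.10] -/
theorem selmerLocalKer_le_unramifiedKer_of_not_dvd_localTamagawaNumber
    {v : HeightOneSpectrum (𝓞 K)} (hpv : (p : 𝓞 K) ∉ v.asIdeal)
    (hc : ¬ p ∣ (W.baseChange (v.adicCompletion K)).localTamagawaNumber (v.adicCompletionIntegers K))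
    {𝔓 : Ideal (absIntegers (𝓞 K) K)} (h𝔓 : 𝔓 ∈ v.primesAbove) :
    selmerLocalKer W (v.adicCompletion K) (p : ℤ) ≤ unramifiedKer (geomTorsion W (p : ℤ)) 𝔓 :=
  (selmerLocalKer_eq_unramifiedKer_of_not_dvd_localTamagawaNumber W p hpv hc h𝔓).le


/-! ## §3. Two curves: the local conditions of `p`-congruent curves AGREE at a place Tamagawa-free for both -/

section TwoCurves

variable (W' : WeierstrassCurve K) [W'.IsElliptic]

/-- **The local Selmer conditions of `p`-congruent curves agree at a place `v ∤ p` Tamagawa-free for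
both** — the `hagree` binder of x10's `SelmerCompanions.natCard_selmerGroup_eq_of_congr_of_agree_rat` at
`v`: for a `Γ_K`-equivariant isomorphism `θ : E′[p] ⥲ E[p]`, a finite place `v ∤ p` (any reduction
types of `E`, `E′` at `v`, `p = 2` allowed) with `p ∤ c_v(E)` and `p ∤ c_v(E′)`, a class
`c′ ∈ H¹(K, E′[p])` satisfies the local Selmer condition of `E′` at `v` iff `θ_* c′` satisfies that of
`E`: both conditions are "unramified at `𝔓₀`" ((L1) on both sides) and unramifiedness passes through
`θ` (`mem_unramifiedKer_iff_h1Equiv_mem`).  Mazur–Rubin, *Kolyvagin systems* §2.3 / *Selmer companion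
curves* Thm. 3.1 shape at `v ∤ p`. [cite: MilneADT2006, Ch. I Prop. 3.8 and Remark 3.10]
[cite: MazurRubin2004, §2.3] [cite: CremonaMazur2000, §3] -/
theorem selmerLocalKer_iff_h1Equiv_of_not_dvd_localTamagawaNumber
    (θ : geomTorsion W' (p : ℤ) ≃+ geomTorsion W (p : ℤ))
    (hθ : ∀ (σ : absoluteGaloisGroup K) (P : geomTorsion W' (p : ℤ)), θ (σ • P) = σ • θ P)
    (v : HeightOneSpectrum (𝓞 K)) (hpv : (p : 𝓞 K) ∉ v.asIdeal)
    (hc : ¬ p ∣ (W.baseChange (v.adicCompletion K)).localTamagawaNumber (v.adicCompletionIntegers K))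
    (hc' : ¬ p ∣ (W'.baseChange (v.adicCompletion K)).localTamagawaNumber (v.adicCompletionIntegers K))
    (c' : galH1Torsion W' (p : ℤ)) :
    c' ∈ selmerLocalKer W' (v.adicCompletion K) (p : ℤ) ↔
      h1Equiv θ hθ c' ∈ selmerLocalKer W (v.adicCompletion K) (p : ℤ) := by
  have h𝔓₀ := adicCompletionPrime_mem_primesAbove K v
  rw [selmerLocalKer_eq_unramifiedKer_of_not_dvd_localTamagawaNumber W' p hpv hc' h𝔓₀,
    selmerLocalKer_eq_unramifiedKer_of_not_dvd_localTamagawaNumber W p hpv hc h𝔓₀]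
  exact mem_unramifiedKer_iff_h1Equiv_mem W W' θ hθ _ c'


/-- Product form of the hypothesis: `p ∤ c_v(E) · c_v(E′)` (the shape `p ∤ Tam(E) · Tam(A)` of x10's
consumer (C-i), read at one place). [cite: MilneADT2006, Ch. I Prop. 3.8 and Remark 3.10] -/
theorem selmerLocalKer_iff_h1Equiv_of_not_dvd_localTamagawaNumber_mul
    (θ : geomTorsion W' (p : ℤ) ≃+ geomTorsion W (p : ℤ))
    (hθ : ∀ (σ : absoluteGaloisGroup K) (P : geomTorsion W' (p : ℤ)), θ (σ • P) = σ • θ P)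
    (v : HeightOneSpectrum (𝓞 K)) (hpv : (p : 𝓞 K) ∉ v.asIdeal)
    (hcc' : ¬ p ∣ (W.baseChange (v.adicCompletion K)).localTamagawaNumber (v.adicCompletionIntegers K) *
      (W'.baseChange (v.adicCompletion K)).localTamagawaNumber (v.adicCompletionIntegers K))
    (c' : galH1Torsion W' (p : ℤ)) :
    c' ∈ selmerLocalKer W' (v.adicCompletion K) (p : ℤ) ↔
      h1Equiv θ hθ c' ∈ selmerLocalKer W (v.adicCompletion K) (p : ℤ) :=
  selmerLocalKer_iff_h1Equiv_of_not_dvd_localTamagawaNumber W p W' θ hθ v hpv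
    (fun h ↦ hcc' (dvd_mul_of_dvd_left h _)) (fun h ↦ hcc' (dvd_mul_of_dvd_right h _)) c'


/-- One-sided form: `θ_* 𝓢_v(E′) ≤ 𝓢_v(E)` at a place `v ∤ p` Tamagawa-free for both curves.
[cite: MilneADT2006, Ch. I Prop. 3.8 and Remark 3.10] [cite: CremonaMazur2000, §3] -/
theorem h1Equiv_mem_selmerLocalKer_of_not_dvd_localTamagawaNumber
    (θ : geomTorsion W' (p : ℤ) ≃+ geomTorsion W (p : ℤ))
    (hθ : ∀ (σ : absoluteGaloisGroup K) (P : geomTorsion W' (p : ℤ)), θ (σ • P) = σ • θ P)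
    {v : HeightOneSpectrum (𝓞 K)} (hpv : (p : 𝓞 K) ∉ v.asIdeal)
    (hc : ¬ p ∣ (W.baseChange (v.adicCompletion K)).localTamagawaNumber (v.adicCompletionIntegers K))
    (hc' : ¬ p ∣ (W'.baseChange (v.adicCompletion K)).localTamagawaNumber (v.adicCompletionIntegers K))
    {c' : galH1Torsion W' (p : ℤ)} (hmem : c' ∈ selmerLocalKer W' (v.adicCompletion K) (p : ℤ)) :
    h1Equiv θ hθ c' ∈ selmerLocalKer W (v.adicCompletion K) (p : ℤ) :=
  (selmerLocalKer_iff_h1Equiv_of_not_dvd_localTamagawaNumber W p W' θ hθ v hpv hc hc' c').mp hmem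


/-- **`ι_v(θ) = 1` at a place `v ∤ p` Tamagawa-free for both curves** — the comparison index of
`CongruenceVisibilityComparison` (`relIndex_map_selmerLocalKer_eq_one_iff`) is `1`: such a place is FREE
in the refined visibility count `exists_sha_ne_zero_of_congr_of_le_off`, with no named fact and no
reduction-type hypothesis. [cite: CremonaMazur2000, §3] [cite: MilneADT2006, Ch. I Prop. 3.8 and Remark 3.10] -/
theorem relIndex_map_selmerLocalKer_eq_one_of_not_dvd_localTamagawaNumber
    (θ : geomTorsion W' (p : ℤ) ≃+ geomTorsion W (p : ℤ))
    (hθ : ∀ (σ : absoluteGaloisGroup K) (P : geomTorsion W' (p : ℤ)), θ (σ • P) = σ • θ P)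
    {v : HeightOneSpectrum (𝓞 K)} (hpv : (p : 𝓞 K) ∉ v.asIdeal)
    (hc : ¬ p ∣ (W.baseChange (v.adicCompletion K)).localTamagawaNumber (v.adicCompletionIntegers K))
    (hc' : ¬ p ∣ (W'.baseChange (v.adicCompletion K)).localTamagawaNumber (v.adicCompletionIntegers K)) :
    (selmerLocalKer W (v.adicCompletion K) (p : ℤ)).relIndex
        ((selmerLocalKer W' (v.adicCompletion K) (p : ℤ)).map (h1Equiv θ hθ).toAddMonoidHom) = 1 :=
  (relIndex_map_selmerLocalKer_eq_one_iff W W' θ hθ).mpr fun c hmem ↦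
    (selmerLocalKer_iff_h1Equiv_of_not_dvd_localTamagawaNumber W p W' θ hθ v hpv hc hc' c).mp hmem


end TwoCurves

end Summit.BirchSwinnertonDyer.Rank1Residual.GaloisImage.InertiaDivisible

end
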